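import Summits.CriticalPhenomena.PercolationContinuityZ3.Theorems.Transplant.FKConnectivityAllQAntipodalAnd4Contracted
import HarnessLib

/-!
# Connectivity correlation inequalities for `φ_{w,q}`, every `q > 0` — file 30: `C_∞` at level 3 for the PATH `S = P₄` — the side inputs in
# full generality (ambient re-rooting by Duffin's lemma; the |W| = 3 side drift when the virtual junction edge `bm` is ALREADY an edge)

Support file (`--supports stmt-CriticalPhenomena-4575`), FK sub-lane `prim-bschramm-fk-2` (gen 19) of the post-continuity programme; builds
on p205010 (kernel theorem, internal audit signed; external expert review pending).  No definitions, no named facts, no sorries; standard axioms.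

The junction theorems of files 27–29a (`and4_series_nonpos`, `and4_parallel_nonpos`, `and4_theta_nonpos`) take as inputs signed side
functionals; files 27a/28a/29a produced them from gen 11's kernel theorems under the side condition that the virtual junction edges `bm`, `mc`
of the series junction are absent from the host graph.  This file removes that condition, so that the induction over the series–parallel
structure of `H \ bc` (file 30a) runs unconditionally:
* `FK.and1_side_nonpos'` — the single-edge (Theorem U) side drift for `uv` on `N ⊆ E`, `E` ANY two-terminal series–parallel network between
  `u, v` with `uv ∉ N` (`apPsi_edge_nonpos_of_isTTSP` with its sub-network freedom, through the bridge); the ambient `E` is supplied by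
  Duffin's lemma `IsTTSP.insert_edge_of_mem` (the completed graph is TTSP between the ends of each of its edges);
* `FK.and2_side_nonpos_of_mem` — the |W| = 3 side drift `∑_{γ ⊆ N₁} (q^{k(γ∪{uv,st})+k(N₁\γ)} - q^{k((N₁\γ)∪{uv,st})+k(γ)}) h(γ) ≤ 0` for
  `E = N₁ ∪ {uv}` TTSP between `s, t` when `st ∈ N₁` (the virtual edge doubles a real one; in the series junction `uv = ab`, `st = bm`):
  splitting `γ` by the `st`-coordinate, the functional is the |W| = 3 drift on `N₁ \ st` against `h(· ∪ st)`, plus the `st`-CONTRACTED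
  Theorem-U drift of `uv` against `h`, plus `∑ (q^{Ȳ'+G'} - q^{Ȳ'+B'})(h(γ' ∪ st) - h(γ'))` with `B' = k(γ' ∪ st) ≤ G' = k(γ')` — three
  nonpositive terms (`0 < q ≤ 1`, `h` monotone);
* `FK.and2_side_nonpos'` — the |W| = 3 side drift for EVERY `E = N₁ ∪ {uv}` TTSP between `s, t` (`uv ∉ N₁`): `st ∉ E` is gen 11's theorem
  (`and2_side_nonpos`), `st = uv` degenerates to Theorem U, `st ∈ N₁` is the previous lemma.
[cite: Grimmett2006, §1.4 eq. (1.20) (p. 15); §3.8 Thm. (3.90) (pp. 61–62); §3.9 (pp. 63–64)] [cite: Wagner2006, Thm. 5.8(d), §5.3]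
-/

noncomputable section

namespace Summit.CriticalPhenomena.PercolationContinuityZ3.Theorems

namespace FK

open SimpleGraph Literature.Probability.LatticeModels Literature.Probability.Percolation
open scoped Classical

variable {V : Type*} [Fintype V]

section Sides

variable {s t u v : V}

/-- **Side input U in an arbitrary ambient network.**  `E` TTSP between `u, v`, `N ⊆ E`, `uv ∉ N`: for every `h` monotone on the subsets
of `N` and `0 < q ≤ 1`, `∑_{γ ⊆ N} (q^{k(γ ∪ uv) + k(N\γ)} - q^{k((N\γ) ∪ uv) + k(γ)}) h(γ) ≤ 0` — Theorem U for the sub-network `N` of `E`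
(`apPsi_edge_nonpos_of_isTTSP`) through the bridge. [cite: Grimmett2006, §3.9 (pp. 63–64)] [cite: Wagner2006, Thm. 5.8(d), §5.3] -/
theorem and1_side_nonpos' {q : ℝ} (hq0 : 0 < q) (hq1 : q ≤ 1) {E N : Finset (Sym2 V)} (hE : IsTTSP E u v) (hN : N ⊆ E)
    (huv : s(u, v) ∉ N) {h : Finset (Sym2 V) → ℝ} (hmono : ∀ ⦃A B : Finset (Sym2 V)⦄, A ⊆ B → B ⊆ N → h A ≤ h B) :
    ∑ γ ∈ N.powerset,
        (q ^ (clusterCount (↑(insert s(u, v) γ) : BondConfig V) ∅ + clusterCount (↑(N \ γ) : BondConfig V) ∅) -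
            q ^ (clusterCount (↑(insert s(u, v) (N \ γ)) : BondConfig V) ∅ + clusterCount (↑γ : BondConfig V) ∅)) * h γ ≤ 0 := by
  set G : Finset (Sym2 V) → ℝ := fun X => h (X ∩ N) with hG
  have hGmono : ∀ ⦃A B : Finset (Sym2 V)⦄, A ⊆ B → B ⊆ N → G A ≤ G B := fun A B hAB _ =>
    hmono (Finset.inter_subset_inter hAB le_rfl) Finset.inter_subset_right
  have hGy : ∀ A : Finset (Sym2 V), G (insert s(u, v) A) = G A := fun A => by
    simp only [hG, Finset.insert_inter_of_notMem huv]
  have key := apPsi_edge_nonpos_of_isTTSP hq0 hq1 hE hN huv hGy hGmono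
  have hNS : Disjoint N {s(u, v)} := Finset.disjoint_singleton_right.2 huv
  have hE' : insert s(u, v) N = N ∪ {s(u, v)} := by rw [union_singleton_eq_insert]
  have hf : (fun A : Finset (Sym2 V) => if s(u, v) ∈ A then (1 : ℝ) else 0) =
      fun A => if ({s(u, v)} : Finset (Sym2 V)) ⊆ A then 1 else 0 := by
    funext A; simp only [Finset.singleton_subset_iff]
  have hg' : ∀ A T : Finset (Sym2 V), T ⊆ {s(u, v)} → G (A ∪ T) = G A := by
    intro A T hT
    simp only [hG, Finset.union_inter_distrib_right]
    have : T ∩ N = ∅ := Finset.disjoint_iff_inter_eq_empty.1 (Finset.disjoint_of_subset_left hT hNS.symm)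
    rw [this, Finset.union_empty]
  rw [hE', hf, apPsi_andInd_eq q hNS ⟨s(u, v), Finset.mem_singleton_self _⟩ hg'] at key
  have hsum : ∑ γ ∈ N.powerset,
      (q ^ (clusterCount (↑(insert s(u, v) γ) : BondConfig V) ∅ + clusterCount (↑(N \ γ) : BondConfig V) ∅) -
          q ^ (clusterCount (↑(insert s(u, v) (N \ γ)) : BondConfig V) ∅ + clusterCount (↑γ : BondConfig V) ∅)) * h γ =
      ∑ γ ∈ N.powerset, (q ^ (clusterCount (↑(γ ∪ {s(u, v)}) : BondConfig V) ∅ + clusterCount (↑(N \ γ) : BondConfig V) ∅) -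
          q ^ (clusterCount (↑(N \ γ ∪ {s(u, v)}) : BondConfig V) ∅ + clusterCount (↑γ : BondConfig V) ∅)) * G γ := by
    refine Finset.sum_congr rfl fun γ hγ => ?_
    rw [Finset.mem_powerset] at hγ
    rw [union_singleton_eq_insert, union_singleton_eq_insert]
    simp only [hG, Finset.inter_eq_left.2 hγ]
  rw [hsum]
  linarith

/-- **Side input Y when the virtual junction edge doubles a real one.**  `E = N₁ ∪ {uv}` TTSP between `s, t`, `uv ∉ N₁`, `st ∈ N₁`: for every
`h` monotone on the subsets of `N₁` and `0 < q ≤ 1`, `∑_{γ ⊆ N₁} (q^{k(γ ∪ {uv,st}) + k(N₁\γ)} - q^{k((N₁\γ) ∪ {uv,st}) + k(γ)}) h(γ) ≤ 0`.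
With `N' = N₁ \ st`, `Y' = k(γ'∪{uv,st})`, `G' = k(γ')`, `B' = k(γ'∪st)` (and bars for `N' \ γ'`), the sum is
`∑_{γ'} (q^{Y'+Ḡ'} - q^{Ȳ'+G'}) h(γ'∪st) + ∑_{γ'} (q^{Y'+B̄'} - q^{Ȳ'+B'}) h(γ') + ∑_{γ'} (q^{Ȳ'+G'} - q^{Ȳ'+B'})(h(γ'∪st) - h(γ'))`:
the |W| = 3 drift on `N'` (both one-edge forms inside `E`, TTSP between `u, v` and between `s, t` by Duffin's lemma), the `st`-contracted
Theorem-U drift of `uv` (`apPsiC_edge_nonpos_of_isTTSP`), and a pointwise nonpositive remainder.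
[cite: Grimmett2006, §3.9 (pp. 63–64)] [cite: Wagner2006, Thm. 5.8(d), §5.3] -/
theorem and2_side_nonpos_of_mem {q : ℝ} (hq0 : 0 < q) (hq1 : q ≤ 1) {N₁ : Finset (Sym2 V)} (hE : IsTTSP (insert s(u, v) N₁) s t)
    (huvN : s(u, v) ∉ N₁) (hstN : s(s, t) ∈ N₁) {h : Finset (Sym2 V) → ℝ}
    (hmono : ∀ ⦃A B : Finset (Sym2 V)⦄, A ⊆ B → B ⊆ N₁ → h A ≤ h B) :
    ∑ γ ∈ N₁.powerset,
        (q ^ (clusterCount (↑(insert s(s, t) (insert s(u, v) γ)) : BondConfig V) ∅ + clusterCount (↑(N₁ \ γ) : BondConfig V) ∅) -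
            q ^ (clusterCount (↑(insert s(s, t) (insert s(u, v) (N₁ \ γ))) : BondConfig V) ∅ + clusterCount (↑γ : BondConfig V) ∅)) *
          h γ ≤ 0 := by
  set N' := N₁.erase s(s, t) with hN'
  have hN₁ : N₁ = insert s(s, t) N' := (Finset.insert_erase hstN).symm
  have hstN' : s(s, t) ∉ N' := Finset.notMem_erase _ _
  have huvN' : s(u, v) ∉ N' := fun hh => huvN (Finset.mem_of_mem_erase hh)
  have hne : s(u, v) ≠ s(s, t) := fun hh => huvN (hh ▸ hstN)
  have hN'N : N' ⊆ N₁ := Finset.erase_subset _ _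
  -- `E` is TTSP between `u, v` as well (Duffin)
  have hEuv : IsTTSP (insert s(u, v) N₁) u v := by
    have key := hE.insert_edge_of_mem (x := u) (y := v) (Finset.mem_insert_of_mem (Finset.mem_insert_self _ _))
    rwa [Finset.insert_eq_of_mem (Finset.mem_insert_of_mem hstN)] at key
  have hE' : insert s(u, v) N₁ = insert s(s, t) (insert s(u, v) N') := by
    rw [hN₁, Finset.insert_comm]
  -- (1) the |W| = 3 drift on `N'` against `h(· ∪ st)`
  have hY : ∑ γ ∈ N'.powerset,
      (q ^ (clusterCount (↑(insert s(s, t) (insert s(u, v) γ)) : BondConfig V) ∅ + clusterCount (↑(N' \ γ) : BondConfig V) ∅) -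
          q ^ (clusterCount (↑(insert s(s, t) (insert s(u, v) (N' \ γ))) : BondConfig V) ∅ + clusterCount (↑γ : BondConfig V) ∅)) *
        h (insert s(s, t) γ) ≤ 0 := by
    set G : Finset (Sym2 V) → ℝ := fun X => h (insert s(s, t) (X ∩ N')) with hG
    have hGmono : ∀ ⦃A B : Finset (Sym2 V)⦄, A ⊆ B → G A ≤ G B := fun A B hAB =>
      hmono (Finset.insert_subset_insert _ (Finset.inter_subset_inter hAB le_rfl))
        (Finset.insert_subset hstN (Finset.inter_subset_right.trans hN'N))
    have hGx : ∀ A : Finset (Sym2 V), G (insert s(u, v) A) = G A := fun A => by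
      simp only [hG, Finset.insert_inter_of_notMem huvN']
    have hGy : ∀ A : Finset (Sym2 V), G (insert s(s, t) A) = G A := fun A => by
      simp only [hG, Finset.insert_inter_of_notMem hstN']
    -- one-edge form at `uv`: ambient `E`, TTSP between `u, v`
    have hx : apPsi q (insert s(u, v) (insert s(s, t) N')) (fun A => if s(u, v) ∈ A then 1 else 0) G ≤ 0 := by
      have hM : insert s(s, t) N' ⊆ insert s(u, v) N₁ := by rw [← hN₁]; exact Finset.subset_insert _ _
      have hxM : s(u, v) ∉ insert s(s, t) N' := by rw [← hN₁]; exact huvN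
      exact apPsi_edge_nonpos_of_isTTSP hq0 hq1 hEuv hM hxM hGx fun A B hAB _ => hGmono hAB
    -- one-edge form at `st`: ambient `E`, TTSP between `s, t`
    have hy : apPsi q (insert s(s, t) (insert s(u, v) N')) (fun A => if s(s, t) ∈ A then 1 else 0) G ≤ 0 := by
      have hM : insert s(u, v) N' ⊆ insert s(u, v) N₁ := Finset.insert_subset_insert _ hN'N
      have hyM : s(s, t) ∉ insert s(u, v) N' := by
        rw [Finset.mem_insert, not_or]; exact ⟨hne.symm, hstN'⟩
      exact apPsi_edge_nonpos_of_isTTSP hq0 hq1 hE hM hyM hGy fun A B hAB _ => hGmono hAB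
    rw [Finset.insert_comm] at hx
    have h2 := apPsi_two_edges_eq q (E := insert s(s, t) (insert s(u, v) N')) (x := s(u, v)) (y := s(s, t))
      (Finset.mem_insert_of_mem (Finset.mem_insert_self _ _)) (Finset.mem_insert_self _ _) G
    have hNS : Disjoint N' ({s(u, v), s(s, t)} : Finset (Sym2 V)) := by
      rw [Finset.disjoint_insert_right, Finset.disjoint_singleton_right]; exact ⟨huvN', hstN'⟩
    have hg' : ∀ A T : Finset (Sym2 V), T ⊆ {s(u, v), s(s, t)} → G (A ∪ T) = G A := by
      intro A T hT
      simp only [hG, Finset.union_inter_distrib_right]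
      have : T ∩ N' = ∅ := Finset.disjoint_iff_inter_eq_empty.1 (Finset.disjoint_of_subset_left hT hNS.symm)
      rw [this, Finset.union_empty]
    have key := apPsi_andInd_eq q hNS ⟨s(u, v), Finset.mem_insert_self _ _⟩ hg'
    have hE' : N' ∪ {s(u, v), s(s, t)} = insert s(s, t) (insert s(u, v) N') := union_pair_eq_insert _ _ _
    have hf : (fun A : Finset (Sym2 V) => if ({s(u, v), s(s, t)} : Finset (Sym2 V)) ⊆ A then (1 : ℝ) else 0) =
        fun A => if s(u, v) ∈ A ∧ s(s, t) ∈ A then 1 else 0 := by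
      funext A; simp only [Finset.insert_subset_iff, Finset.singleton_subset_iff]
    rw [hE', hf, h2] at key
    have hsum : ∑ γ ∈ N'.powerset,
        (q ^ (clusterCount (↑(insert s(s, t) (insert s(u, v) γ)) : BondConfig V) ∅ + clusterCount (↑(N' \ γ) : BondConfig V) ∅) -
            q ^ (clusterCount (↑(insert s(s, t) (insert s(u, v) (N' \ γ))) : BondConfig V) ∅ + clusterCount (↑γ : BondConfig V) ∅)) *
          h (insert s(s, t) γ) =
        ∑ γ ∈ N'.powerset, (q ^ (clusterCount (↑(γ ∪ {s(u, v), s(s, t)}) : BondConfig V) ∅ + clusterCount (↑(N' \ γ) : BondConfig V) ∅) -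
            q ^ (clusterCount (↑(N' \ γ ∪ {s(u, v), s(s, t)}) : BondConfig V) ∅ + clusterCount (↑γ : BondConfig V) ∅)) * G γ := by
      refine Finset.sum_congr rfl fun γ hγ => ?_
      rw [Finset.mem_powerset] at hγ
      rw [union_pair_eq_insert, union_pair_eq_insert]
      simp only [hG, Finset.inter_eq_left.2 hγ]
    rw [hsum]
    linarith
  -- (2) the `st`-contracted Theorem-U drift of `uv` on `N'` against `h`
  have hC : ∑ γ ∈ N'.powerset,
      (q ^ (clusterCount (↑(insert s(s, t) (insert s(u, v) γ)) : BondConfig V) ∅ +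
            clusterCount (↑(insert s(s, t) (N' \ γ)) : BondConfig V) ∅) -
          q ^ (clusterCount (↑(insert s(s, t) (insert s(u, v) (N' \ γ))) : BondConfig V) ∅ +
            clusterCount (↑(insert s(s, t) γ) : BondConfig V) ∅)) * h γ ≤ 0 := by
    set G : Finset (Sym2 V) → ℝ := fun X => h (X ∩ N') with hG
    have hGmono : ∀ ⦃A B : Finset (Sym2 V)⦄, A ⊆ B → G A ≤ G B := fun A B hAB =>
      hmono (Finset.inter_subset_inter hAB le_rfl) (Finset.inter_subset_right.trans hN'N)
    have hGx : ∀ A : Finset (Sym2 V), G (insert s(u, v) A) = G A := fun A => by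
      simp only [hG, Finset.insert_inter_of_notMem huvN']
    have hxC : s(u, v) ∉ ({s(s, t)} : Finset (Sym2 V)) := by rw [Finset.mem_singleton]; exact hne
    have hCsub : ({s(s, t)} : Finset (Sym2 V)) ⊆ insert s(u, v) N₁ :=
      Finset.singleton_subset_iff.2 (Finset.mem_insert_of_mem hstN)
    have hx : apPsiC q (insert s(u, v) N') {s(s, t)} (fun A => if s(u, v) ∈ A then 1 else 0) G ≤ 0 :=
      apPsiC_edge_nonpos_of_isTTSP hq0 hq1 hEuv ((hN'N).trans (Finset.subset_insert _ _)) hCsub huvN' hxC hGx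
        fun A B hAB _ => hGmono hAB
    have hNS : Disjoint N' ({s(u, v)} : Finset (Sym2 V)) := Finset.disjoint_singleton_right.2 huvN'
    have hSC : Disjoint ({s(u, v)} : Finset (Sym2 V)) {s(s, t)} := Finset.disjoint_singleton_left.2 hxC
    have hg' : ∀ A T : Finset (Sym2 V), T ⊆ {s(u, v)} → G (A ∪ T) = G A := by
      intro A T hT
      simp only [hG, Finset.union_inter_distrib_right]
      have : T ∩ N' = ∅ := Finset.disjoint_iff_inter_eq_empty.1 (Finset.disjoint_of_subset_left hT hNS.symm)
      rw [this, Finset.union_empty]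
    have key := apPsiC_andInd_eq q hNS ⟨s(u, v), Finset.mem_singleton_self _⟩ hSC hg'
    have hE' : N' ∪ {s(u, v)} = insert s(u, v) N' := union_singleton_eq_insert _ _
    have hf : (fun A : Finset (Sym2 V) => if ({s(u, v)} : Finset (Sym2 V)) ⊆ A then (1 : ℝ) else 0) =
        fun A => if s(u, v) ∈ A then 1 else 0 := by
      funext A; simp only [Finset.singleton_subset_iff]
    rw [hE', hf] at key
    have hsum : ∑ γ ∈ N'.powerset,
        (q ^ (clusterCount (↑(insert s(s, t) (insert s(u, v) γ)) : BondConfig V) ∅ +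
              clusterCount (↑(insert s(s, t) (N' \ γ)) : BondConfig V) ∅) -
            q ^ (clusterCount (↑(insert s(s, t) (insert s(u, v) (N' \ γ))) : BondConfig V) ∅ +
              clusterCount (↑(insert s(s, t) γ) : BondConfig V) ∅)) * h γ =
        ∑ γ ∈ N'.powerset, (q ^ (clusterCount (↑(γ ∪ {s(u, v)} ∪ {s(s, t)}) : BondConfig V) ∅ +
              clusterCount (↑(N' \ γ ∪ {s(s, t)}) : BondConfig V) ∅) -
            q ^ (clusterCount (↑(N' \ γ ∪ {s(u, v)} ∪ {s(s, t)}) : BondConfig V) ∅ +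
              clusterCount (↑(γ ∪ {s(s, t)}) : BondConfig V) ∅)) * G (γ ∪ {s(s, t)}) := by
      refine Finset.sum_congr rfl fun γ hγ => ?_
      rw [Finset.mem_powerset] at hγ
      rw [union_singleton_eq_insert, union_singleton_eq_insert, union_singleton_eq_insert, union_singleton_eq_insert,
        union_singleton_eq_insert, union_singleton_eq_insert]
      have hGγ : G (insert s(s, t) γ) = h γ := by
        simp only [hG, Finset.insert_inter_of_notMem hstN', Finset.inter_eq_left.2 hγ]
      rw [hGγ]
    rw [hsum]
    linarith
  -- (3) the split of the sum over `N₁ = N' ∪ {st}` by the `st`-coordinate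
  rw [hN₁, Finset.sum_powerset_insert hstN']
  have e1 : ∀ γ ∈ N'.powerset, insert s(s, t) N' \ γ = insert s(s, t) (N' \ γ) := fun γ hγ =>
    Finset.insert_sdiff_of_notMem _ (fun hh => hstN' (Finset.mem_powerset.1 hγ hh))
  have e2 : ∀ γ : Finset (Sym2 V), insert s(s, t) N' \ insert s(s, t) γ = N' \ γ := fun γ => by
    rw [Finset.insert_sdiff_insert, Finset.sdiff_insert_of_notMem hstN']
  have e3 : ∀ γ : Finset (Sym2 V), insert s(s, t) (insert s(u, v) (insert s(s, t) γ)) = insert s(s, t) (insert s(u, v) γ) := fun γ => by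
    rw [Finset.insert_comm s(u, v) s(s, t), Finset.insert_idem]
  have hS1 : ∑ γ ∈ N'.powerset,
      (q ^ (clusterCount (↑(insert s(s, t) (insert s(u, v) γ)) : BondConfig V) ∅ +
            clusterCount (↑(insert s(s, t) N' \ γ) : BondConfig V) ∅) -
          q ^ (clusterCount (↑(insert s(s, t) (insert s(u, v) (insert s(s, t) N' \ γ))) : BondConfig V) ∅ +
            clusterCount (↑γ : BondConfig V) ∅)) * h γ =
      ∑ γ ∈ N'.powerset,
      (q ^ (clusterCount (↑(insert s(s, t) (insert s(u, v) γ)) : BondConfig V) ∅ +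
            clusterCount (↑(insert s(s, t) (N' \ γ)) : BondConfig V) ∅) -
          q ^ (clusterCount (↑(insert s(s, t) (insert s(u, v) (N' \ γ))) : BondConfig V) ∅ + clusterCount (↑γ : BondConfig V) ∅)) *
        h γ := by
    refine Finset.sum_congr rfl fun γ hγ => ?_
    rw [e1 γ hγ, e3 (N' \ γ)]
  have hS2 : ∑ γ ∈ N'.powerset,
      (q ^ (clusterCount (↑(insert s(s, t) (insert s(u, v) (insert s(s, t) γ))) : BondConfig V) ∅ +
            clusterCount (↑(insert s(s, t) N' \ insert s(s, t) γ) : BondConfig V) ∅) -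
          q ^ (clusterCount (↑(insert s(s, t) (insert s(u, v) (insert s(s, t) N' \ insert s(s, t) γ))) : BondConfig V) ∅ +
            clusterCount (↑(insert s(s, t) γ) : BondConfig V) ∅)) * h (insert s(s, t) γ) =
      ∑ γ ∈ N'.powerset,
      (q ^ (clusterCount (↑(insert s(s, t) (insert s(u, v) γ)) : BondConfig V) ∅ + clusterCount (↑(N' \ γ) : BondConfig V) ∅) -
          q ^ (clusterCount (↑(insert s(s, t) (insert s(u, v) (N' \ γ))) : BondConfig V) ∅ +
            clusterCount (↑(insert s(s, t) γ) : BondConfig V) ∅)) * h (insert s(s, t) γ) := by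
    refine Finset.sum_congr rfl fun γ _ => ?_
    rw [e2 γ, e3 γ]
  rw [hS1, hS2]
  -- (4) pointwise: the two sums are (1) + (2) + a nonpositive remainder
  have hB : ∀ γ : Finset (Sym2 V), q ^ clusterCount (↑γ : BondConfig V) ∅ ≤ q ^ clusterCount (↑(insert s(s, t) γ) : BondConfig V) ∅ := by
    intro γ
    have i := clusterCount_insert_add_ite γ s t
    exact pow_le_pow_of_le_one hq0.le hq1 (by omega)
  have rem : ∑ γ ∈ N'.powerset,
      (q ^ (clusterCount (↑(insert s(s, t) (insert s(u, v) (N' \ γ))) : BondConfig V) ∅ + clusterCount (↑γ : BondConfig V) ∅) -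
        q ^ (clusterCount (↑(insert s(s, t) (insert s(u, v) (N' \ γ))) : BondConfig V) ∅ +
          clusterCount (↑(insert s(s, t) γ) : BondConfig V) ∅)) * (h (insert s(s, t) γ) - h γ) ≤ 0 := by
    refine Finset.sum_nonpos fun γ hγ => ?_
    rw [Finset.mem_powerset] at hγ
    refine mul_nonpos_of_nonpos_of_nonneg ?_ (sub_nonneg.2 (hmono (Finset.subset_insert _ _) (Finset.insert_subset hstN (hγ.trans hN'N))))
    rw [pow_add, pow_add]
    exact sub_nonpos.2 (mul_le_mul_of_nonneg_left (hB γ) (pow_nonneg hq0.le _))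
  have split : ∑ γ ∈ N'.powerset,
        (q ^ (clusterCount (↑(insert s(s, t) (insert s(u, v) γ)) : BondConfig V) ∅ +
              clusterCount (↑(insert s(s, t) (N' \ γ)) : BondConfig V) ∅) -
            q ^ (clusterCount (↑(insert s(s, t) (insert s(u, v) (N' \ γ))) : BondConfig V) ∅ + clusterCount (↑γ : BondConfig V) ∅)) * h γ +
      ∑ γ ∈ N'.powerset,
        (q ^ (clusterCount (↑(insert s(s, t) (insert s(u, v) γ)) : BondConfig V) ∅ + clusterCount (↑(N' \ γ) : BondConfig V) ∅) -
            q ^ (clusterCount (↑(insert s(s, t) (insert s(u, v) (N' \ γ))) : BondConfig V) ∅ +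
              clusterCount (↑(insert s(s, t) γ) : BondConfig V) ∅)) * h (insert s(s, t) γ) =
      ∑ γ ∈ N'.powerset,
        (q ^ (clusterCount (↑(insert s(s, t) (insert s(u, v) γ)) : BondConfig V) ∅ + clusterCount (↑(N' \ γ) : BondConfig V) ∅) -
            q ^ (clusterCount (↑(insert s(s, t) (insert s(u, v) (N' \ γ))) : BondConfig V) ∅ + clusterCount (↑γ : BondConfig V) ∅)) *
          h (insert s(s, t) γ) +
      ∑ γ ∈ N'.powerset,
        (q ^ (clusterCount (↑(insert s(s, t) (insert s(u, v) γ)) : BondConfig V) ∅ +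
              clusterCount (↑(insert s(s, t) (N' \ γ)) : BondConfig V) ∅) -
            q ^ (clusterCount (↑(insert s(s, t) (insert s(u, v) (N' \ γ))) : BondConfig V) ∅ +
              clusterCount (↑(insert s(s, t) γ) : BondConfig V) ∅)) * h γ +
      ∑ γ ∈ N'.powerset,
        (q ^ (clusterCount (↑(insert s(s, t) (insert s(u, v) (N' \ γ))) : BondConfig V) ∅ + clusterCount (↑γ : BondConfig V) ∅) -
          q ^ (clusterCount (↑(insert s(s, t) (insert s(u, v) (N' \ γ))) : BondConfig V) ∅ +
            clusterCount (↑(insert s(s, t) γ) : BondConfig V) ∅)) * (h (insert s(s, t) γ) - h γ) := by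
    rw [← Finset.sum_add_distrib, ← Finset.sum_add_distrib, ← Finset.sum_add_distrib]
    refine Finset.sum_congr rfl fun γ _ => ?_
    ring
  rw [split]
  linarith

/-- **Side input Y in full generality.**  `E = N₁ ∪ {uv}` TTSP between `s, t`, `uv ∉ N₁`: for every `h` monotone on the subsets of `N₁` and
`0 < q ≤ 1`, `∑_{γ ⊆ N₁} (q^{k(γ ∪ {uv,st}) + k(N₁\γ)} - q^{k((N₁\γ) ∪ {uv,st}) + k(γ)}) h(γ) ≤ 0` — the three cases `st ∉ E` (gen 11,
`and2_side_nonpos`), `st = uv` (Theorem U, `and1_side_nonpos'`), `st ∈ N₁` (`and2_side_nonpos_of_mem`).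
[cite: Grimmett2006, §3.9 (pp. 63–64)] [cite: Wagner2006, Thm. 5.8(d), §5.3] -/
theorem and2_side_nonpos' {q : ℝ} (hq0 : 0 < q) (hq1 : q ≤ 1) {N₁ : Finset (Sym2 V)} (hE : IsTTSP (insert s(u, v) N₁) s t)
    (huvN : s(u, v) ∉ N₁) {h : Finset (Sym2 V) → ℝ} (hmono : ∀ ⦃A B : Finset (Sym2 V)⦄, A ⊆ B → B ⊆ N₁ → h A ≤ h B) :
    ∑ γ ∈ N₁.powerset,
        (q ^ (clusterCount (↑(insert s(s, t) (insert s(u, v) γ)) : BondConfig V) ∅ + clusterCount (↑(N₁ \ γ) : BondConfig V) ∅) -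
            q ^ (clusterCount (↑(insert s(s, t) (insert s(u, v) (N₁ \ γ))) : BondConfig V) ∅ + clusterCount (↑γ : BondConfig V) ∅)) *
          h γ ≤ 0 := by
  by_cases hbm : s(s, t) ∈ insert s(u, v) N₁
  · rcases Finset.mem_insert.1 hbm with heq | hmem
    · -- `st = uv`: the functional is the Theorem-U drift of `uv`
      have hE' : IsTTSP (insert s(u, v) N₁) u v := by
        rcases Sym2.eq_iff.1 heq with ⟨h1, h2⟩ | ⟨h1, h2⟩
        · have key := hE; rw [h1, h2] at key; exact key
        · have key := hE.symm; rw [h2, h1] at key; exact key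
      have key := and1_side_nonpos' hq0 hq1 hE' (Finset.subset_insert _ _) huvN hmono
      have hsum : ∀ γ : Finset (Sym2 V), insert s(s, t) (insert s(u, v) γ) = insert s(u, v) γ := fun γ => by
        rw [heq]; exact Finset.insert_eq_of_mem (Finset.mem_insert_self _ _)
      simp_rw [hsum]
      exact key
    · exact and2_side_nonpos_of_mem hq0 hq1 hE huvN hmem hmono
  · have key := and2_side_nonpos hq0 hq1 hE hbm (Finset.mem_insert_self _ _) (h := h)
      (by rw [Finset.erase_insert huvN]; exact hmono)
    rwa [Finset.erase_insert huvN] at key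

end Sides

end FK

end Summit.CriticalPhenomena.PercolationContinuityZ3.Theorems

end
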